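import Literature.Probability.RandomPlanarGeometry.HexSAWBrickWallSlabUpWalks
import Literature.Probability.RandomPlanarGeometry.HexSAWStripPairsTransfer
import Literature.Probability.RandomPlanarGeometry.HexSAWSurfaceYcLimit
import Literature.Probability.RandomPlanarGeometry.HexSAWBridgeLength
import HarnessLib

/-!
# Locality of the connective constant of the honeycomb lattice in ARMCHAIR SLABS: `μ(Slab_H) → μ_ℍ`
# (Beaton 2014 Proposition 9, convergence part at `y = 1`), via Duminil-Copin–Smirnov's strip bridges read as up-walks

Topic `Literature/Probability/RandomPlanarGeometry` (continues `HexSAWBrickWallSlabUpWalks.lean` — the up-walks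
`HexBW.upWalks M` of the brick wall placed at `e = (1,0)`, their end-column fibres `HexBW.upFiber M h`, the pigeonhole
`#upWalks M ≤ (2M+1)·#upFiber M h`, the reflected blocks `(#upFiber M h)² ≤ #levelUp 2M 2M` and
`#levelUp L W ^ j ≤ #levelUp (jL) W ≤ c_{jL}(Slab_{3W+1})` — and `HexSAWBrickWallSlab.lean` — the armchair slabs
`Slab_H = {0,…,H} × ℤ` of the brick wall (= the honeycomb lattice `ℍ`), `HexBW.slabConnectiveConstant H = μ(Slab_H)`,
`μ(Slab_H) ≤ μ(Slab_{H+1}) ≤ μ_ℍ`).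

Sources.  N. Madras, G. Slade, *The Self-Avoiding Walk* (1993), Theorem 8.2.1, eq. (8.2.12), p. 269:
"`lim_{T→∞} μ(R[k,T]) = μ`" for the tubes/slabs `R[k,T]` of (8.2.1) (p. 267), with its proof (p. 269): axis-ending bridges
`b_s(0)` (Definition 8.1.1, p. 259) started at the centre of `R[k,2s]` concatenate inside it — the concatenation bound (8.2.14),
`c_{js}(R[k,2s]) ≥ b_s(0)^j` for every `j ≥ 1`, "Hence `μ(R[k, 2s]) ≥ μ − ε`" — with `lim b_N(0)^{1/N} = μ` from Lemma 8.1.8,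
Proposition 8.1.2 and Corollary 3.2.5 (here replaced: the lane's device of `HexSAWBrickWallSlabUpWalks.lean` — pigeonhole over the
end column and reflected blocks — needs only `μ_Bridge = μ`, Corollary 3.1.6 (3.1.10) p. 61, which is taken by length in the
Duminil-Copin–Smirnov strip frame); N. R. Beaton, *The critical surface fugacity of self-avoiding walks on a
rotated honeycomb lattice*, J. Phys. A 47 (2014) 075003, arXiv:1210.0274v3, §3.2 Proposition 9 (p. 15), for the walks confined
to the strip of height `T` of the ROTATED (armchair) honeycomb lattice: "For `y > 0`, `μ_T(1,y) < μ_{T+1}(1,y)`. Moreover, as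
`T → ∞`, `μ_T(1,y) → μ(y)`, where `μ(y)` is as defined in Proposition 7" — "The proof is virtually identical to that of
Proposition 7 in [BBdGDCG14], and we direct interested readers to that article. (The only difference is that the special 'prime'
arch used in that proof will necessarily be modified so as to fit on our lattice.)"; at `y = 1`, `μ(1) = μ_ℍ = √(2+√2)`
[DuminilCopinSmirnov2012, Theorem 1].  FRAME: Beaton's strips of the rotated lattice are the column
slabs `Slab_H` of the tree's brick wall (index shift by one column, `HexSAWBrickWallSlab.lean` header; the strict part
`μ(Slab_H) < μ(Slab_{H+1})` is the tree's `HexSAWBrickWallSlabStrict.lean`).  The input "`μ_Bridge = μ`" is taken in the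
Duminil-Copin–Smirnov strip frame and BY LENGTH: the tree's `HV.eventually_pow_le_hvBridgeLen` (`τ^{2m} ≤ b_{2m}(ℍ)`
eventually, every `τ < μ_ℍ`, from the divergence `Σ_T B_T(x_c) = ∞` regraded by length — no unfolding).

## The argument

(1) TRANSPORT (`HV.toUpWalk_mem_upWalks`, `hvBridgeLen_le_card_upWalks`).  A Duminil-Copin–Smirnov bridge of width `T` with
`n` vertices — a self-avoiding `hvGraph`-chain `l` from `O` in the levels `0,…,2T−1` ending on the level `2T−1`
(`HV.bridgeLists`) — completed by its exit vertex `upOf (last l)` (level `2T`) and read in brick-wall coordinates through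
the rotated dictionary `HexBW.rowIso` (`HV.toPair` of `HexSAWStripPairsTransfer.lean`: rows = `⌊level/2⌋`) is an `n`-step
self-avoiding shape placed at `hvToRow O = (−1, 0) ≡ e = (1, 0)` (cross-section representative), using brick-wall bonds,
with rows in `{0,…,T−1}` before the last vertex and row `T` at the last vertex: an UP-WALK with `n` steps and end row `T`
(`HexBW.upWalks n`).  The reading is injective for a fixed width and the end row records the width, so
`b_n(ℍ) = Σ_T #{bridges of width T, n vertices} ≤ #upWalks n`.
(2) COUNTING (`card_upFiber_rpow_le_slabConnectiveConstant`, `hvBridgeLen_div_rpow_le_slabConnectiveConstant`).  With the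
previous file: for the best end column `h`, `F := #upFiber n h ≥ b_n(ℍ)/(2n+1)` and `F^{2j} ≤ c_{2jn}(Slab_{6n+1})` for every
`j`, whence (Fekete in the slab, `HexBW.tendsto_slabCount_rpow`) `F^{1/n} ≤ μ(Slab_{6n+1})`:
**`(b_n(ℍ)/(2n+1))^{1/n} ≤ μ(Slab_{6n+1})`** for every `n ≥ 1` — Madras–Slade (8.2.14) on the armchair slabs of `ℍ`.
(3) LIMIT (`eventually_le_slabConnectiveConstant`, `tendsto_slabConnectiveConstant`).  For `τ < τ' < μ_ℍ`, eventually
`(4m+1) τ^{2m} ≤ τ'^{2m} ≤ b_{2m}(ℍ)`, so `τ ≤ μ(Slab_{12m+1})`; with `μ(Slab_H) ↑` in `H` and `μ(Slab_H) ≤ μ_ℍ`: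
**`μ(Slab_H) → μ_ℍ`** and `μ_ℍ = sup_H μ(Slab_H)`.

## Main statements (all PROVED; no rate is claimed — the tree has no Hammersley–Welsh unfolding ACROSS the rows of the
brick wall, so the `30/√T` rate of the row-strip twin `HexSAWBrickWallStripLocality.lean` has no analogue here)

* `HV.upExt`, `HV.toUpWalk`, `HV.toUpWalk_mem_upWalks`, `HV.toUpWalk_last_row`, `HV.toUpWalk_injOn`;
* `hvBridgeLen_le_card_upWalks : hvBridgeLen n ≤ #HexBW.upWalks n`;
* `HexBW.rpow_le_slabConnectiveConstant`, `HexBW.card_upFiber_rpow_le_slabConnectiveConstant`,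
  **`HexBW.hvBridgeLen_div_rpow_le_slabConnectiveConstant`** — `(b_n(ℍ)/(2n+1))^{1/n} ≤ μ(Slab_{6n+1})` (`n ≥ 1`);
* `HexBW.eventually_le_slabConnectiveConstant` — `τ < μ_ℍ ⇒ τ ≤ μ(Slab_{12m+1})` eventually;
* **`HexBW.tendsto_slabConnectiveConstant`** — `μ(Slab_H) → μ_ℍ`; `HexBW.iSup_slabConnectiveConstant` — `sup_H μ(Slab_H) = μ_ℍ`;
  `HexBW.exists_lt_slabConnectiveConstant` — every `τ < μ_ℍ` is exceeded by some `μ(Slab_H)`.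
-/

noncomputable section

open Finset Filter Topology Literature.Probability.LatticeModels Literature.Probability.Percolation SimpleGraph

namespace Literature.Probability.RandomPlanarGeometry.SAW

/-! ### (1) Transport: Duminil-Copin–Smirnov bridges, completed by their exit vertex, are up-walks -/

namespace HV

/-- The completed bridge: the vertex list `l` followed by the vertex `upOf (last l)` above its last vertex (for a bridge
of width `T`, the exit vertex on the level `2T`). [cite: DuminilCopinSmirnov2012, §3 (the walks a → β leave S_{T,L} through β)] -/
def upExt (l : List HV) : List HV := l ++ [upOf (l.getLast?.getD hvOrigin)]

/-- `upExt l = l ++ [upOf (l.getLast _)]` for a non-empty list. [cite: DuminilCopinSmirnov2012, §3] -/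
theorem upExt_eq {l : List HV} (hl : l ≠ []) : upExt l = l ++ [upOf (l.getLast hl)] := by
  rw [upExt, List.getLast?_eq_some_getLast hl]
  rfl

/-- The up-walk of a honeycomb vertex list: the brick-wall reading (through `HexBW.rowIso`, re-based at the origin) of the
completed list, `(HV.toPair (upExt l)).2`. [cite: MadrasSlade1993, §8.2, proof of Theorem 8.2.1 (p. 269: the bridges used in (8.2.14))] -/
def toUpWalk (l : List HV) : ℕ → Site 2 := (toPair (upExt l)).2

/-- The brick-wall site of the origin `O` of the coordinate model is `(−1, 0)`, whose cross-section representative is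
`e = (1, 0)`. [cite: EntingJensen2009, §7.4.2, Fig. 7.10 (brickwork form of the honeycomb lattice)] -/
theorem snorm_hvToRow_hvOrigin : HexBW.snorm (HexBW.hvToRow hvOrigin) = HexBW.bwE := by
  funext i
  fin_cases i
  · show HexBW.snorm (HexBW.hvToRow hvOrigin) 0 = HexBW.bwE 0
    rw [HexBW.snorm_apply_zero, HexBW.hvToRow_apply_zero, HexBW.bwE_apply_zero]
    simp [hvOrigin]
  · show HexBW.snorm (HexBW.hvToRow hvOrigin) 1 = HexBW.bwE 1
    rw [HexBW.snorm_apply_one, HexBW.hvToRow_apply_one, HexBW.bwE_apply_one]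
    rfl

/-- The row (coordinate `1`) of `hvToRow O` is `0`. [cite: EntingJensen2009, §7.4.2, Fig. 7.10] -/
theorem hvToRow_hvOrigin_apply_one : HexBW.hvToRow hvOrigin 1 = 0 := by
  rw [HexBW.hvToRow_apply_one]; rfl

/-- The head of the brick-wall copy of a list from `O` is `hvToRow O`. [cite: EntingJensen2009, §7.4.2, Fig. 7.10] -/
theorem headD_toBWList {M : List HV} (hh : M.head? = some hvOrigin) :
    (toBWList M).headD 0 = HexBW.hvToRow hvOrigin := by
  have hne : M ≠ [] := by rintro rfl; simp at hh
  obtain ⟨x, M', rfl⟩ := List.exists_cons_of_ne_nil hne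
  have hx : x = hvOrigin := by simpa using hh
  subst hx
  simp [toBWList]

/-- Data of a bridge of width `T` with `n` vertices: the facts about the completed list `l⁺ = upExt l = l ++ [u]` used below —
`l⁺` is a self-avoiding `hvGraph`-chain from `O` with `n + 1` vertices and levels in `[0, 2T]`, the members of `l` have second
coordinate in `[0, T−1]`, and `u` has second coordinate `T`.
[cite: DuminilCopinSmirnov2012, §3 (bridges of S_T: from level 0 to level 2T−1, exit through β)] -/
theorem upExt_spec {T L n : ℕ} (hT : 1 ≤ T) {l : List HV} (hl : l ∈ bridgeLists T L) (hn : l.length = n) :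
    ∃ u : HV, upExt l = l ++ [u] ∧ (upExt l).IsChain hvGraph.Adj ∧ l.head? = some hvOrigin ∧
      (upExt l).head? = some hvOrigin ∧ (upExt l).Nodup ∧ (upExt l).length = n + 1 ∧
      (∀ w ∈ upExt l, 0 ≤ lev w ∧ lev w ≤ 2 * ((T + 1 : ℕ) : ℤ) - 1) ∧
      (∀ w ∈ l, 0 ≤ w.2.1 ∧ w.2.1 + 1 ≤ (T : ℤ)) ∧ u.2.1 = T := by
  obtain ⟨hc, hh, hnd, hV, hne, hlast⟩ := (mem_bridgeLists_iff hT).1 hl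
  set v := l.getLast hne with hv
  have hlevv : lev v = 2 * v.2.1 + bit v := rfl
  have hbitv : bit v = if v.2.2 then 1 else 0 := rfl
  -- the last vertex is of type `1` on the row `T − 1`
  have htyp : v.2.2 = true := by
    by_contra hf
    rw [Bool.not_eq_true] at hf
    rw [hf] at hbitv
    simp only [Bool.false_eq_true, ↓reduceIte] at hbitv
    omega
  have hbit1 : bit v = 1 := by rw [hbitv, htyp]; rfl
  have hrow : v.2.1 = (T : ℤ) - 1 := by omega
  have hadj : hvGraph.Adj v (upOf v) := by
    obtain ⟨a, b, c⟩ := v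
    simp only at htyp
    subst htyp
    simp [upOf, hvGraph_adj, AdjRel]
  have hlevup : lev (upOf v) = 2 * T := by
    have h1 : lev (upOf v) = 2 * (upOf v).2.1 + bit (upOf v) := rfl
    have h2 : bit (upOf v) = 0 := rfl
    have h3 : (upOf v).2.1 = v.2.1 + 1 := rfl
    omega
  have hrows : ∀ w ∈ l, 0 ≤ w.2.1 ∧ w.2.1 + 1 ≤ (T : ℤ) := by
    intro w hw
    have h1 := mem_stripV_iff.1 (hV w hw)
    have h2 : lev w = 2 * w.2.1 + bit w := rfl
    have h3 : 0 ≤ bit w := by unfold bit; split_ifs <;> norm_num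
    refine ⟨h1.1, ?_⟩
    omega
  have hnotmem : upOf v ∉ l := fun hmem => by
    have := (lev_mem_of_mem_stripV (hV _ hmem)).2
    omega
  have heq : upExt l = l ++ [upOf v] := upExt_eq hne
  refine ⟨upOf v, heq, ?_, hh, ?_, ?_, ?_, ?_, hrows, ?_⟩
  · rw [heq]
    refine List.IsChain.append hc (List.isChain_singleton _) fun x hx y hy => ?_
    rw [List.getLast?_eq_some_getLast hne, Option.mem_def, Option.some.injEq] at hx
    simp only [List.head?_cons, Option.mem_def, Option.some.injEq] at hy
    subst hx; subst hy
    exact hadj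
  · rw [heq, List.head?_append, hh]
    rfl
  · rw [heq, List.nodup_append]
    refine ⟨hnd, List.nodup_singleton _, fun x hx y hy => ?_⟩
    rw [List.mem_singleton] at hy
    subst hy
    exact fun hxy => hnotmem (hxy ▸ hx)
  · rw [heq, List.length_append, List.length_singleton, hn]
  · intro w hw
    rw [heq, List.mem_append, List.mem_singleton] at hw
    rcases hw with hw | rfl
    · have := lev_mem_of_mem_stripV (hV w hw)
      push_cast
      omega
    · rw [hlevup]
      push_cast
      omega
  · show (upOf v).2.1 = T
    have h3 : (upOf v).2.1 = v.2.1 + 1 := rfl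
    omega

/-- **A completed Duminil-Copin–Smirnov bridge of width `T` with `n` vertices is an up-walk with `n` steps**, and its end
row is `T`. [cite: MadrasSlade1993, §8.2, proof of Theorem 8.2.1, (8.2.14) (p. 269); DuminilCopinSmirnov2012, §3 (bridges)] -/
theorem toUpWalk_mem_upWalks {T L n : ℕ} (hT : 1 ≤ T) {l : List HV} (hl : l ∈ bridgeLists T L) (hn : l.length = n) :
    toUpWalk l ∈ HexBW.upWalks n ∧ toUpWalk l n 1 = T := by
  obtain ⟨u, heq, hc, hh0, hh, hnd, hlen, hlev, hrows, htop⟩ := upExt_spec hT hl hn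
  have hne' : upExt l ≠ [] := by rw [heq]; simp
  have hmem := toPair_mem (T := T + 1) (by omega) hne' hc hnd hlev
  rw [hlen, Nat.add_sub_cancel, Nat.add_sub_cancel] at hmem
  rw [HexBW.mem_stripPairs] at hmem
  obtain ⟨-, hsaws, hbw, -⟩ := hmem
  -- the head of the brick-wall copy and the first component of the pair
  have hhead : (toBWList (upExt l)).headD 0 = HexBW.hvToRow hvOrigin := headD_toBWList hh
  have hfst : (toPair (upExt l)).1 = HexBW.bwE := by
    show HexBW.snorm ((toBWList (upExt l)).headD 0) = HexBW.bwE
    rw [hhead, snorm_hvToRow_hvOrigin]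
  -- rows of the reading: the second coordinates of the vertices of `l⁺`
  have hlenBW : (toBWList (upExt l)).length = n + 1 := by rw [toBWList, List.length_map, hlen]
  have hlen' : (l ++ [u]).length = n + 1 := by rw [← heq]; exact hlen
  have hrowval : ∀ i (hi : i < n + 1), toUpWalk l i 1 = ((l ++ [u])[i]'(by rw [hlen']; exact hi)).2.1 := by
    intro i hi
    show (HexBW.StripInsertion.ofList (toBWList (upExt l)) i - (toBWList (upExt l)).headD 0) 1 = _
    rw [hhead, Pi.sub_apply, hvToRow_hvOrigin_apply_one, sub_zero,
      HexBW.StripInsertion.ofList_eq_getElem (by rw [hlenBW]; exact hi)]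
    simp [toBWList, List.getElem_map, heq]
  have hln : l.length = n := hn
  have hlastrow : toUpWalk l n 1 = T := by
    rw [hrowval n (by omega), List.getElem_append_right (by omega)]
    simp [hln, htop]
  refine ⟨HexBW.mem_upWalks.2 ⟨hsaws, ?_, fun i hi => ?_⟩, hlastrow⟩
  · have e : (fun i => HexBW.bwE + toUpWalk l i) = fun i => (toPair (upExt l)).1 + (toPair (upExt l)).2 i := by
      rw [hfst]; rfl
    rw [e]
    exact hbw
  · rw [hlastrow, hrowval i (by omega)]
    have hi' : i < l.length := by rw [hn]; exact hi
    rw [List.getElem_append_left hi']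
    exact hrows _ (List.getElem_mem hi')

/-- The end row of the up-walk of a bridge of width `T` is `T`. [cite: DuminilCopinSmirnov2012, §3 (β on the level 2T−1)] -/
theorem toUpWalk_last_row {T L n : ℕ} (hT : 1 ≤ T) {l : List HV} (hl : l ∈ bridgeLists T L) (hn : l.length = n) :
    toUpWalk l n 1 = T :=
  (toUpWalk_mem_upWalks hT hl hn).2

/-- **The reading is injective** on the bridges of a fixed width with a fixed number of vertices.
[cite: MadrasSlade1993, §8.2, proof of Theorem 8.2.1 (p. 269)] -/
theorem toUpWalk_injOn {T L n : ℕ} (hT : 1 ≤ T) :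
    Set.InjOn toUpWalk ↑((bridgeLists T L).filter fun l => l.length = n) := by
  intro l hl l' hl' h
  rw [Finset.mem_coe, Finset.mem_filter] at hl hl'
  obtain ⟨u, heq, -, -, hh, -, hlen, -⟩ := upExt_spec hT hl.1 hl.2
  obtain ⟨u', heq', -, -, hh', -, hlen', -⟩ := upExt_spec hT hl'.1 hl'.2
  have h1 : (toPair (upExt l)).1 = (toPair (upExt l')).1 := by
    show HexBW.snorm ((toBWList (upExt l)).headD 0) = HexBW.snorm ((toBWList (upExt l')).headD 0)
    rw [headD_toBWList hh, headD_toBWList hh']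
  have hpair : toPair (upExt l) = toPair (upExt l') := Prod.ext h1 h
  have hll : upExt l = upExt l' :=
    toPair_inj (by rw [heq]; simp) (by rw [heq']; simp) (by rw [hh, hh']) (by rw [hlen, hlen']) hpair
  rw [heq, heq'] at hll
  exact List.append_inj_left' hll rfl

end HV

/-- **`b_n(ℍ) ≤ #upWalks n`**: the Duminil-Copin–Smirnov strip bridges with `n` vertices (all widths), completed and read in
brick-wall coordinates, are distinct up-walks with `n` steps (the end row records the width).
[cite: MadrasSlade1993, §8.2, proof of Theorem 8.2.1, (8.2.14) (p. 269); DuminilCopinSmirnov2012, §3 (bridges of S_T)] -/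
theorem hvBridgeLen_le_card_upWalks (n : ℕ) : hvBridgeLen n ≤ (HexBW.upWalks n).card := by
  classical
  unfold hvBridgeLen
  have himg : ∀ T ∈ Icc 1 n,
      ((HV.bridgeLists T n).filter fun l => l.length = n).card =
        (((HV.bridgeLists T n).filter fun l => l.length = n).image HV.toUpWalk).card := fun T hT =>
    (Finset.card_image_of_injOn (HV.toUpWalk_injOn (mem_Icc.1 hT).1)).symm
  rw [Finset.sum_congr rfl himg, ← Finset.card_biUnion]
  · refine Finset.card_le_card fun υ hυ => ?_
    rw [Finset.mem_biUnion] at hυ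
    obtain ⟨T, hT, hυ⟩ := hυ
    rw [Finset.mem_image] at hυ
    obtain ⟨l, hl, rfl⟩ := hυ
    rw [Finset.mem_filter] at hl
    exact (HV.toUpWalk_mem_upWalks (mem_Icc.1 hT).1 hl.1 hl.2).1
  · intro T hT T' hT' hne
    rw [Function.onFun, Finset.disjoint_left]
    intro υ hυ hυ'
    rw [Finset.mem_image] at hυ hυ'
    obtain ⟨l, hl, rfl⟩ := hυ
    obtain ⟨l', hl', hll'⟩ := hυ'
    rw [Finset.mem_filter] at hl hl'
    have h1 := HV.toUpWalk_last_row (mem_Icc.1 (Finset.mem_coe.1 hT)).1 hl.1 hl.2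
    have h2 := HV.toUpWalk_last_row (mem_Icc.1 (Finset.mem_coe.1 hT')).1 hl'.1 hl'.2
    rw [hll'] at h2
    rw [h1] at h2
    exact hne (by exact_mod_cast h2)

namespace HexBW

/-! ### (2) Counting in the slab: `(b_n(ℍ)/(2n+1))^{1/n} ≤ μ(Slab_{6n+1})` -/

/-- From `B^j ≤ c_{jM}(Slab_H)` for all `j` (`H, M ≥ 1`): `B^{1/M} ≤ μ(Slab_H)`, by `c_N(Slab_H)^{1/N} → μ(Slab_H)` along
`N = jM`. [cite: MadrasSlade1993, §8.2, proof of Theorem 8.2.1 (p. 269)] -/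
theorem rpow_le_slabConnectiveConstant {H M B : ℕ} (hH : 1 ≤ H) (hM : 1 ≤ M)
    (h : ∀ j : ℕ, B ^ j ≤ slabCount H (j * M)) :
    (B : ℝ) ^ (1 / (M : ℝ)) ≤ slabConnectiveConstant H := by
  have hsub : Tendsto (fun j : ℕ => j * M) atTop atTop := tendsto_id.atTop_mul_const' (by omega)
  have hlim := (tendsto_slabCount_rpow hH).comp hsub
  refine ge_of_tendsto hlim ?_
  filter_upwards [eventually_ge_atTop 1] with j hj
  have hB : (0 : ℝ) ≤ B := Nat.cast_nonneg _
  rw [Function.comp_apply]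
  have h1 : ((B : ℝ) ^ j) ^ (1 / ((j * M : ℕ) : ℝ)) = (B : ℝ) ^ (1 / (M : ℝ)) := by
    rw [← Real.rpow_natCast, ← Real.rpow_mul hB]
    congr 1
    have hj' : (j : ℝ) ≠ 0 := by exact_mod_cast (show j ≠ 0 by omega)
    push_cast
    field_simp
  rw [← h1]
  exact Real.rpow_le_rpow (pow_nonneg hB _) (by exact_mod_cast h j) (by positivity)

/-- **`(#upFiber n h)^{1/n} ≤ μ(Slab_{6n+1})`** (`n ≥ 1`): `F^{2j} ≤ #levelUp(2n,2n)^j ≤ #levelUp(2jn, 2n) ≤ c_{2jn}(Slab_{6n+1})`.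
[cite: MadrasSlade1993, §8.2, proof of Theorem 8.2.1, (8.2.14) (p. 269)] -/
theorem card_upFiber_rpow_le_slabConnectiveConstant {n : ℕ} (hn : 1 ≤ n) (h : ℤ) :
    ((upFiber n h).card : ℝ) ^ (1 / (n : ℝ)) ≤ slabConnectiveConstant (6 * n + 1) := by
  have key : ∀ j : ℕ, ((upFiber n h).card ^ 2) ^ j ≤ slabCount (6 * n + 1) (j * (2 * n)) := fun j =>
    calc ((upFiber n h).card ^ 2) ^ j ≤ (levelUp (n + n) (2 * n)).card ^ j :=
          Nat.pow_le_pow_left (sq_card_upFiber_le n h) j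
      _ ≤ (levelUp (j * (n + n)) (2 * n)).card := card_levelUp_pow_le _ _ _
      _ ≤ slabCount (3 * (2 * n) + 1) (j * (n + n)) := card_levelUp_le_slabCount _ _
      _ = slabCount (6 * n + 1) (j * (2 * n)) := by ring_nf
  have h1 := rpow_le_slabConnectiveConstant (H := 6 * n + 1) (M := 2 * n) (B := (upFiber n h).card ^ 2)
    (by omega) (by omega) key
  have hF : (0 : ℝ) ≤ (upFiber n h).card := Nat.cast_nonneg _
  have e : (((upFiber n h).card ^ 2 : ℕ) : ℝ) ^ (1 / ((2 * n : ℕ) : ℝ)) = ((upFiber n h).card : ℝ) ^ (1 / (n : ℝ)) := by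
    push_cast
    rw [← Real.rpow_natCast ((upFiber n h).card : ℝ) 2, ← Real.rpow_mul hF]
    congr 1
    have hn' : (n : ℝ) ≠ 0 := by exact_mod_cast (show n ≠ 0 by omega)
    push_cast
    field_simp
  rwa [e] at h1

/-- **Madras–Slade (8.2.14) on the armchair slabs of the honeycomb lattice**: for every `n ≥ 1`,
`(b_n(ℍ)/(2n+1))^{1/n} ≤ μ(Slab_{6n+1})`, where `b_n(ℍ) = hvBridgeLen n` counts Duminil-Copin–Smirnov's strip bridges with
`n` vertices. [cite: MadrasSlade1993, §8.2, proof of Theorem 8.2.1, (8.2.14) (p. 269: the concatenation bound and "Hence μ(R[k, 2s]) ≥ μ − ε"; lane device: end-column pigeonhole)] -/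
theorem hvBridgeLen_div_rpow_le_slabConnectiveConstant {n : ℕ} (hn : 1 ≤ n) :
    ((hvBridgeLen n : ℝ) / (2 * n + 1)) ^ (1 / (n : ℝ)) ≤ slabConnectiveConstant (6 * n + 1) := by
  obtain ⟨h, hh⟩ := exists_card_upWalks_le n
  have hb : (hvBridgeLen n : ℝ) ≤ (2 * n + 1) * (upFiber n h).card := by
    exact_mod_cast (hvBridgeLen_le_card_upWalks n).trans hh
  have hpos : (0 : ℝ) < 2 * n + 1 := by positivity
  have hdiv : (hvBridgeLen n : ℝ) / (2 * n + 1) ≤ (upFiber n h).card := by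
    rw [div_le_iff₀ hpos]; linarith
  exact (Real.rpow_le_rpow (by positivity) hdiv (by positivity)).trans
    (card_upFiber_rpow_le_slabConnectiveConstant hn h)

/-! ### (3) The limit `μ(Slab_H) → μ_ℍ` -/

/-- For `0 ≤ τ < τ'`: eventually `(4m+1) τ^{2m} ≤ τ'^{2m}` (`m (τ/τ')^{2m} → 0`). [folklore] -/
private theorem eventually_linear_mul_pow_le {τ τ' : ℝ} (hτ : 0 ≤ τ) (hττ' : τ < τ') :
    ∀ᶠ m : ℕ in atTop, (4 * (m : ℝ) + 1) * τ ^ (2 * m) ≤ τ' ^ (2 * m) := by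
  have hτ' : 0 < τ' := hτ.trans_lt hττ'
  set q : ℝ := (τ / τ') ^ 2 with hq
  have hq0 : 0 ≤ q := by positivity
  have hq1 : q < 1 := by
    rw [hq]
    have : τ / τ' < 1 := (div_lt_one hτ').2 hττ'
    have h0 : 0 ≤ τ / τ' := by positivity
    nlinarith
  have hlim := tendsto_self_mul_const_pow_of_lt_one hq0 hq1
  have hev : ∀ᶠ m : ℕ in atTop, (m : ℝ) * q ^ m ≤ 1 / 5 := hlim.eventually (Iic_mem_nhds (by norm_num))
  filter_upwards [hev, eventually_ge_atTop 1] with m hm hm1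
  have hm1' : (1 : ℝ) ≤ m := by exact_mod_cast hm1
  have hqm : q ^ m = τ ^ (2 * m) / τ' ^ (2 * m) := by
    rw [hq, ← pow_mul, div_pow, mul_comm 2 m]
  have hpos : 0 < τ' ^ (2 * m) := pow_pos hτ' _
  have h5 : (4 * (m : ℝ) + 1) * q ^ m ≤ 1 := by nlinarith [pow_nonneg hq0 m]
  rw [hqm, ← mul_div_assoc, div_le_one hpos] at h5
  exact h5

/-- **Every `τ < μ_ℍ` is eventually below `μ(Slab_{12m+1})`**: combine `τ'^{2m} ≤ b_{2m}(ℍ)` eventually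
(`HV.eventually_pow_le_hvBridgeLen`, `τ < τ' < μ_ℍ`), `(4m+1) τ^{2m} ≤ τ'^{2m}` eventually, and
`(b_{2m}/(4m+1))^{1/(2m)} ≤ μ(Slab_{12m+1})`. [cite: MadrasSlade1993, Theorem 8.2.1 (8.2.12) and its proof, (8.2.14) (p. 269); Corollary 3.1.6 (3.1.10) (p. 61)] -/
theorem eventually_le_slabConnectiveConstant {τ : ℝ} (hτ0 : 0 < τ) (hτ : τ < hexConnectiveConstant) :
    ∀ᶠ m : ℕ in atTop, τ ≤ slabConnectiveConstant (12 * m + 1) := by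
  set τ' := (τ + hexConnectiveConstant) / 2 with hτ'def
  have hττ' : τ < τ' := by rw [hτ'def]; linarith
  have hτ'μ : τ' < hexConnectiveConstant := by rw [hτ'def]; linarith
  have hτ'0 : 0 < τ' := hτ0.trans hττ'
  filter_upwards [HV.eventually_pow_le_hvBridgeLen hτ'0 hτ'μ, eventually_linear_mul_pow_le hτ0.le hττ',
    eventually_ge_atTop 1] with m hb hlin hm1
  have hn : 1 ≤ 2 * m := by omega
  have hkey := hvBridgeLen_div_rpow_le_slabConnectiveConstant hn
  have e12 : 6 * (2 * m) + 1 = 12 * m + 1 := by ring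
  rw [e12] at hkey
  refine le_trans ?_ hkey
  have hpos : (0 : ℝ) < 2 * ((2 * m : ℕ) : ℝ) + 1 := by positivity
  -- `τ^{2m} ≤ b_{2m}/(4m+1)`
  have hle : τ ^ (2 * m) ≤ (hvBridgeLen (2 * m) : ℝ) / (2 * ((2 * m : ℕ) : ℝ) + 1) := by
    rw [le_div_iff₀ hpos]
    have e4 : (2 * ((2 * m : ℕ) : ℝ) + 1) = 4 * (m : ℝ) + 1 := by push_cast; ring
    rw [e4, mul_comm]
    exact hlin.trans hb
  have hm0 : (0 : ℝ) < ((2 * m : ℕ) : ℝ) := by exact_mod_cast (show 0 < 2 * m by omega)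
  calc τ = (τ ^ (2 * m)) ^ (1 / ((2 * m : ℕ) : ℝ)) := by
        rw [← Real.rpow_natCast, ← Real.rpow_mul hτ0.le, mul_one_div_cancel hm0.ne', Real.rpow_one]
    _ ≤ ((hvBridgeLen (2 * m) : ℝ) / (2 * ((2 * m : ℕ) : ℝ) + 1)) ^ (1 / ((2 * m : ℕ) : ℝ)) :=
        Real.rpow_le_rpow (pow_nonneg hτ0.le _) hle (by positivity)

/-- For every `τ < μ_ℍ` some slab has `τ < μ(Slab_H)` (and then all wider slabs do).
[cite: MadrasSlade1993, Theorem 8.2.1 (8.2.12); Beaton2014RotatedHoneycomb, §3.2 Proposition 9 (arXiv v3 p. 15, y = 1)] -/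
theorem exists_lt_slabConnectiveConstant {τ : ℝ} (hτ : τ < hexConnectiveConstant) :
    ∃ H₀ : ℕ, ∀ H, H₀ ≤ H → τ < slabConnectiveConstant H := by
  have hμ : 0 < hexConnectiveConstant := hexConnectiveConstant_pos
  obtain ⟨σ, hσ1, hσ2⟩ := exists_between (max_lt hτ hμ)
  have hσ0 : 0 < σ := (le_max_right _ _).trans_lt hσ1
  have hτσ : τ < σ := (le_max_left _ _).trans_lt hσ1
  obtain ⟨m, hm⟩ := (eventually_le_slabConnectiveConstant hσ0 hσ2).exists
  exact ⟨12 * m + 1, fun H hH => hτσ.trans_le (hm.trans (slabConnectiveConstant_mono hH))⟩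

/-- **Beaton 2014 Proposition 9 (convergence part, `y = 1`) / Madras–Slade Theorem 8.2.1 (8.2.12) on the armchair slabs of
the honeycomb lattice**: `lim_{H→∞} μ(Slab_H) = μ_ℍ` — the connective constant of `ℍ` is the limit of the connective
constants of its column slabs (locality in the armchair family; the row-strip family is the tree's
`HexBW.tendsto_stripConnectiveConstant`).  Printed for the rotated honeycomb strips qualitatively (Beaton, by reference to
BBdGDCG 2014 Proposition 7, itself after Janse van Rensburg–Orlandini–Whittington); the proof here is Madras–Slade's (8.2.14)
with Duminil-Copin–Smirnov's strip bridges read as up-walks and `μ_Bridge = μ` by length in the strip frame.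
[cite: Beaton2014RotatedHoneycomb, §3.2 Proposition 9 (arXiv v3 p. 15: "Moreover, as T → ∞, μ_T(1,y) → μ(y)"), y = 1]
[cite: MadrasSlade1993, Theorem 8.2.1 (8.2.12) and its proof, (8.2.14) (p. 269); Corollary 3.1.6 (3.1.10) (p. 61)]
[cite: DuminilCopinSmirnov2012, Theorem 1 and §3] -/
theorem tendsto_slabConnectiveConstant :
    Tendsto (fun H : ℕ => slabConnectiveConstant H) atTop (𝓝 hexConnectiveConstant) := by
  refine tendsto_order.2 ⟨fun a ha => ?_, fun a ha => ?_⟩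
  · obtain ⟨H₀, hH₀⟩ := exists_lt_slabConnectiveConstant ha
    filter_upwards [eventually_ge_atTop H₀] with H hH using hH₀ H hH
  · filter_upwards [eventually_ge_atTop 1] with H hH using (slabConnectiveConstant_le hH).trans_lt ha

/-- **`μ_ℍ = sup_H μ(Slab_H)`**: the slab constants increase to the connective constant of the honeycomb lattice (with the
tree's strict inequalities `μ(Slab_H) < μ(Slab_{H+1}) < μ_ℍ` of `HexSAWBrickWallSlabStrict.lean` this is Beaton's Proposition 9
at `y = 1` in full). [cite: Beaton2014RotatedHoneycomb, §3.2 Proposition 9 (arXiv v3 p. 15), y = 1] [cite: MadrasSlade1993, Theorem 8.2.1, eq. (8.2.12)] -/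
theorem iSup_slabConnectiveConstant : (⨆ H : ℕ, slabConnectiveConstant H) = hexConnectiveConstant := by
  have h1 : ∀ H, slabConnectiveConstant H ≤ hexConnectiveConstant := fun H => by
    rcases Nat.eq_zero_or_pos H with rfl | hH
    · exact (slabConnectiveConstant_mono (Nat.zero_le 1)).trans (slabConnectiveConstant_le le_rfl)
    · exact slabConnectiveConstant_le hH
  have hbdd : BddAbove (Set.range slabConnectiveConstant) := ⟨hexConnectiveConstant, by rintro _ ⟨H, rfl⟩; exact h1 H⟩
  have hmono : Monotone slabConnectiveConstant := fun _ _ h => slabConnectiveConstant_mono h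
  exact tendsto_nhds_unique (tendsto_atTop_ciSup hmono hbdd) tendsto_slabConnectiveConstant

end HexBW

end Literature.Probability.RandomPlanarGeometry.SAW
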